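import Summits.HodgeConjecture.HodgeConjecture.Theses.HeckePrymWeil
import Summits.HodgeConjecture.HodgeConjecture.Theorems.HeckePrymWeilHeckePrymAnchorsUpgrade
import Summits.HodgeConjecture.HodgeConjecture.Theorems.HeckePrymWeilWeilSixfoldsSqrtMinus7AimedPartnerOfFacts
import Literature.AlgebraicGeometry.HodgeTheory.WeilClassesSixfolds
import HarnessLib

/-!
# Crux `WeilSixfoldsSqrtMinus7` (stmt-HodgeConjecture-1260) · the split by discriminant, kernel-checked

Route `HeckePrymWeil`, crux `WeilSixfoldsSqrtMinus7` (rung `(7,2)`): every rational `(3,3)`-class of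
the Weil plane `Eig((𝟙+φ)^*, (1+i√7)⁶) ⊔ Eig((𝟙+φ)^*, (1-i√7)⁶) ⊆ H⁶(A(ℂ); ℂ)` of a complex abelian
SIXFOLD `A` with `φ ≫ φ = -7` is algebraic — ALL discriminants `det H ∈ ℚ^×/Nm ℚ(√-7)^×`.

Status in print (read 2026-08-16): the HYPERBOLIC components (`det H = -1`, Witt index 3) are
Markman's theorem (arXiv:2502.03415, Thm. 1.5.1, every imaginary quadratic `K`), vendored as the
named fact `HodgeTheory.Markman2025_weilClasses_algebraic_hyperbolicSixfold`; "outside this locus,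
the Hodge conjecture for Weil classes on sixfolds remains completely open" (arXiv:2603.20268, p. 3).

Nothing here proves the crux. This file (line lead c3 of the crux, skeleton r7 of line
`hyperbolic-eightfold-descent`) records against the route decl BY NAME exactly what is open:

* `weilSixfoldsSqrtMinus7_of_markmanSplit_of_nonHyperbolic` — GIVEN Markman's split-sixfold theorem,
  the crux follows from its restriction to the pairs `(A, φ)` admitting NO hyperbolic
  `K`-symmetrised hyperplane class `h = 7·ι^*a + φ^*ι^*a` (`Motives.IsHyperbolicWeilType A φ 3 h`
  for a projective embedding `ι` and a rational `a ≠ 0`), i.e. to the non-split components; the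
  route's single-operator typing of the Weil plane is upgraded to the Literature plane
  `weilClassesOf A φ 3 7` by the landed `HeckePrymWeilLine.stub_upgrade` at `(p, k) = (7, 3)`.
* `nonHyperbolic_of_weilSixfoldsSqrtMinus7` and `weilSixfoldsSqrtMinus7_iff_nonHyperbolic_of_markmanSplit`
  — the residual is a restriction of the crux, so modulo the named fact the crux IS its non-split
  residual.
* `nonHyperbolic_of_hyperbolicEightfoldsSqrtMinus7` — the residual from the split EIGHTFOLD crux
  `HyperbolicEightfoldsSqrtMinus7` (stmt-HodgeConjecture-14642) alone, through the landed
  `weilSixfoldsSqrtMinus7_of_hyperbolicEightfoldsSqrtMinus7` (line `hyperbolic-eightfold-descent`,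
  aimed CM partner + Schoen descent, unconditional).

CONDITIONAL results where Markman's fact is a hypothesis; no definition, no `sorry`. Deliberately NOT
here: the second reduction of the crux (real quadratic base change, `…OfSplitSecantClass`), and the
reductions to `WeilVariationalHodge` (`HeckePrymWeilCmLadderReach`, `HeckePrymWeilHodgeWeilOfLevelStructure`).
-/

noncomputable section

-- every declaration of this problem lives in `Summit.HodgeConjecture.HodgeConjecture.…`
set_option linter.dupNamespace false

open CategoryTheory
open Literature.AlgebraicGeometry Literature.AlgebraicGeometry.Motives
  Literature.AlgebraicGeometry.HodgeTheory
open Summit.HodgeConjecture.HodgeConjecture.Theses.HeckePrymWeil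

namespace Summit.HodgeConjecture.HodgeConjecture.Theorems.WeilSixfoldsSqrtMinus7.MarkmanSplit

/-- **Hyperbolic components (Markman) + non-hyperbolic residual ⇒ the crux.** Granted the named fact
`Markman2025_weilClasses_algebraic_hyperbolicSixfold` (arXiv:2502.03415 Thm. 1.5.1 at `d = 7`),
`WeilSixfoldsSqrtMinus7` follows from its restriction to the pairs `(A, φ)` that admit no hyperbolic
`K`-symmetrised hyperplane class `7·ι^*a + φ^*ι^*a`. Proof: by cases on the existence of a hyperbolic
`(ι, a)`; in the hyperbolic case the class lies in `weilClassesOf A φ 3 7` by `stub_upgrade (7, 3)` and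
`A.X` is smooth projective of dimension `6` (`AbelianVariety.isSmoothProjective_holds`), so the fact
applies. CONDITIONAL on the named fact. Registered composition stub of crux stmt-HodgeConjecture-1260
(skeleton r7 of line `hyperbolic-eightfold-descent`). [cite: Markman2025SecantWeil, Thm. 1.5.1]
[cite: vanGeemen1994HodgeAV, Lemma 5.2 and 5.4] -/
theorem weilSixfoldsSqrtMinus7_of_markmanSplit_of_nonHyperbolic :
    Markman2025_weilClasses_algebraic_hyperbolicSixfold →
    (∀ (A : AbelianVariety ℂ) (φ : A ⟶ A), A.dim = 6 → φ ≫ φ = -((7 : ℤ) • 𝟙 A) →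
      (∀ (e : ProjectiveEmbedding A.X) (a : complexBetti (projectiveSpace e.n ℂ) 2),
          IsRationalClass a → a ≠ 0 →
            ¬ IsHyperbolicWeilType A φ 3
              ((7 : ℂ) • complexBetti.map e.ι 2 a +
                complexBetti.map φ.hom.hom.hom 2 (complexBetti.map e.ι 2 a))) →
        ∀ c : complexBetti A.X 6, IsRationalClass c → IsOfHodgeType 6 A.X 6 3 3 c →
          c ∈ Module.End.eigenspace (complexBetti.map (𝟙 A + φ).hom.hom.hom 6).hom
                ((1 + Complex.I * (Real.sqrt (7 : ℝ) : ℂ)) ^ 6) ⊔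
              Module.End.eigenspace (complexBetti.map (𝟙 A + φ).hom.hom.hom 6).hom
                ((1 - Complex.I * (Real.sqrt (7 : ℝ) : ℂ)) ^ 6) →
            c ∈ algebraicClasses A.X 3) →
    Summit.HodgeConjecture.HodgeConjecture.Theses.HeckePrymWeil.WeilSixfoldsSqrtMinus7 := by
  intro hS hres A φ hA hφ c hr hH hW
  by_cases hhyp : ∃ (e : ProjectiveEmbedding A.X) (a : complexBetti (projectiveSpace e.n ℂ) 2),
      IsRationalClass a ∧ a ≠ 0 ∧
        IsHyperbolicWeilType A φ 3
          ((7 : ℂ) • complexBetti.map e.ι 2 a +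
            complexBetti.map φ.hom.hom.hom 2 (complexBetti.map e.ι 2 a))
  · obtain ⟨e, a, ha, ha0, hh⟩ := hhyp
    have hA' : A.dim = 2 * 3 := by rw [hA]
    have hX : IsSmoothProjective (2 * 3) A.X := by
      rw [← hA']
      exact AbelianVariety.isSmoothProjective_holds
    have hφ' : φ ≫ φ = -((((7 : ℕ) : ℤ)) • 𝟙 A) := by exact_mod_cast hφ
    have hφℕ : φ ≫ φ = -((7 : ℕ) • 𝟙 A) := by rw [hφ', natCast_zsmul]
    have hWcl : c ∈ weilClassesOf A φ 3 7 :=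
      Summit.HodgeConjecture.HodgeConjecture.Theorems.HeckePrymWeilLine.stub_upgrade 7 (by norm_num)
        (by norm_num) le_rfl 3 A φ hA' hφ' (by exact_mod_cast hW)
    have hhℕ : IsHyperbolicWeilType A φ 3
        ((((7 : ℕ) : ℂ)) • complexBetti.map e.ι 2 a +
          complexBetti.map φ.hom.hom.hom 2 (complexBetti.map e.ι 2 a)) := by
      exact_mod_cast hh
    exact hS 7 (by norm_num) A φ hA' hX hφℕ e a ha ha0 hhℕ c hr (by exact_mod_cast hH) hWcl
  · push Not at hhyp
    exact hres A φ hA hφ (fun e a ha ha0 ↦ hhyp e a ha ha0) c hr hH hW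

/-- **Crux ⇒ non-hyperbolic residual** (the residual is the crux restricted to the pairs `(A, φ)` with no
hyperbolic `K`-symmetrised hyperplane class; the extra hypothesis is simply dropped). [folklore] -/
theorem nonHyperbolic_of_weilSixfoldsSqrtMinus7 (h : WeilSixfoldsSqrtMinus7) :
    ∀ (A : AbelianVariety ℂ) (φ : A ⟶ A), A.dim = 6 → φ ≫ φ = -((7 : ℤ) • 𝟙 A) →
      (∀ (e : ProjectiveEmbedding A.X) (a : complexBetti (projectiveSpace e.n ℂ) 2),
          IsRationalClass a → a ≠ 0 →
            ¬ IsHyperbolicWeilType A φ 3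
              ((7 : ℂ) • complexBetti.map e.ι 2 a +
                complexBetti.map φ.hom.hom.hom 2 (complexBetti.map e.ι 2 a))) →
        ∀ c : complexBetti A.X 6, IsRationalClass c → IsOfHodgeType 6 A.X 6 3 3 c →
          c ∈ Module.End.eigenspace (complexBetti.map (𝟙 A + φ).hom.hom.hom 6).hom
                ((1 + Complex.I * (Real.sqrt (7 : ℝ) : ℂ)) ^ 6) ⊔
              Module.End.eigenspace (complexBetti.map (𝟙 A + φ).hom.hom.hom 6).hom
                ((1 - Complex.I * (Real.sqrt (7 : ℝ) : ℂ)) ^ 6) →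
            c ∈ algebraicClasses A.X 3 :=
  fun A φ hA hφ _ c hr hH hW ↦ h A φ hA hφ c hr hH hW

/-- **Given Markman's split-sixfold theorem, the crux IS its non-hyperbolic residual**:
`WeilSixfoldsSqrtMinus7 ↔` (the Hodge–Weil classes are algebraic on every `(A, φ)`, `dim A = 6`,
`φ² = -7`, admitting no hyperbolic `K`-symmetrised hyperplane class) — the precise open content of
stmt-HodgeConjecture-1260 (arXiv:2603.20268 p. 3). CONDITIONAL on the named fact.
[cite: Markman2025SecantWeil, Thm. 1.5.1] -/
theorem weilSixfoldsSqrtMinus7_iff_nonHyperbolic_of_markmanSplit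
    (hS : Markman2025_weilClasses_algebraic_hyperbolicSixfold) :
    WeilSixfoldsSqrtMinus7 ↔
      ∀ (A : AbelianVariety ℂ) (φ : A ⟶ A), A.dim = 6 → φ ≫ φ = -((7 : ℤ) • 𝟙 A) →
        (∀ (e : ProjectiveEmbedding A.X) (a : complexBetti (projectiveSpace e.n ℂ) 2),
            IsRationalClass a → a ≠ 0 →
              ¬ IsHyperbolicWeilType A φ 3
                ((7 : ℂ) • complexBetti.map e.ι 2 a +
                  complexBetti.map φ.hom.hom.hom 2 (complexBetti.map e.ι 2 a))) →
          ∀ c : complexBetti A.X 6, IsRationalClass c → IsOfHodgeType 6 A.X 6 3 3 c →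
            c ∈ Module.End.eigenspace (complexBetti.map (𝟙 A + φ).hom.hom.hom 6).hom
                  ((1 + Complex.I * (Real.sqrt (7 : ℝ) : ℂ)) ^ 6) ⊔
                Module.End.eigenspace (complexBetti.map (𝟙 A + φ).hom.hom.hom 6).hom
                  ((1 - Complex.I * (Real.sqrt (7 : ℝ) : ℂ)) ^ 6) →
              c ∈ algebraicClasses A.X 3 :=
  ⟨nonHyperbolic_of_weilSixfoldsSqrtMinus7, weilSixfoldsSqrtMinus7_of_markmanSplit_of_nonHyperbolic hS⟩

/-- **The non-hyperbolic residual from the split EIGHTFOLD crux alone**: `HyperbolicEightfoldsSqrtMinus7`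
(stmt-HodgeConjecture-14642) gives the whole crux by the landed, unconditional
`weilSixfoldsSqrtMinus7_of_hyperbolicEightfoldsSqrtMinus7` (aimed CM partner `E × E` one genus up +
Schoen's descent), hence in particular its non-split residual. [cite: Schoen1998HodgeWeilAddendum, §10]
[cite: Markman2025SurveySecant, §11.5 Step 2] -/
theorem nonHyperbolic_of_hyperbolicEightfoldsSqrtMinus7 (h : HyperbolicEightfoldsSqrtMinus7) :
    ∀ (A : AbelianVariety ℂ) (φ : A ⟶ A), A.dim = 6 → φ ≫ φ = -((7 : ℤ) • 𝟙 A) →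
      (∀ (e : ProjectiveEmbedding A.X) (a : complexBetti (projectiveSpace e.n ℂ) 2),
          IsRationalClass a → a ≠ 0 →
            ¬ IsHyperbolicWeilType A φ 3
              ((7 : ℂ) • complexBetti.map e.ι 2 a +
                complexBetti.map φ.hom.hom.hom 2 (complexBetti.map e.ι 2 a))) →
        ∀ c : complexBetti A.X 6, IsRationalClass c → IsOfHodgeType 6 A.X 6 3 3 c →
          c ∈ Module.End.eigenspace (complexBetti.map (𝟙 A + φ).hom.hom.hom 6).hom
                ((1 + Complex.I * (Real.sqrt (7 : ℝ) : ℂ)) ^ 6) ⊔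
              Module.End.eigenspace (complexBetti.map (𝟙 A + φ).hom.hom.hom 6).hom
                ((1 - Complex.I * (Real.sqrt (7 : ℝ) : ℂ)) ^ 6) →
            c ∈ algebraicClasses A.X 3 :=
  nonHyperbolic_of_weilSixfoldsSqrtMinus7
    (HyperbolicEightfoldDescent.weilSixfoldsSqrtMinus7_of_hyperbolicEightfoldsSqrtMinus7 h)

end Summit.HodgeConjecture.HodgeConjecture.Theorems.WeilSixfoldsSqrtMinus7.MarkmanSplit

end
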